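import Mathlib
import Summits.Ventures.PercRepro2.SwOutJunctionRegion
import Summits.Ventures.PercRepro2.SwOutSevEsc

/-!
# The escaping points of a several-arms block when the mark `o` lies in a piece (blind cell
PercRepro2, night-4 g23, 2026-08-27; proofs/NIGHT4-G23.md §1)

`SwOutSevEsc` needs an edge leaving the region at EVERY vertex of every piece: at a non-core slab
point the blue (resp. red) cluster of `u` reaches the far end of a dead edge of a red (resp. blue)
piece and leaves through that vertex's boundary edge.  When the mark `o` is a piece vertex it carries
no guaranteed outside edge.  THE REPAIR: only `Q`-points matter, and at a `Q`-point `o ∈ C_R(l)`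
with `h ∉ hull(l)`.  If the far end of the dead edge is `o` itself, then on the T-slab the piece is
red, so `o ∈ C_R(h)` and `l ∈ C_R(h)` — not a `Q`-point; on the B-slab the red dead edge puts `o`
into `C_R(u)`, so `l ∈ C_R(u) ⊆ hull(u)`, which therefore leaves the region.  Hence
**`MixedBaseR.not_hull_u_subset_of_not_core_o`**: the same conclusion with the outside edges
required only at piece vertices other than `o`, for `Q`-points of a region avoiding `l`.
-/

namespace Summit.Ventures.PercRepro2

namespace MixedArms

open Hull LocRows BigBlock

variable {V : Type*} {E : Type*} [Fintype E] [DecidableEq E]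

open scoped Classical

variable {ι ρ ν κ : Type*} {ends : E → Sym2 V} {σ : Config E} {h u : V} {U : ι → Set V}
  {p : ρ → V} {Ah : ν → Set V} {arm : ν → ρ} {F : κ → Set V}

variable (hb : MixedBaseR ends σ h u U p Ah arm F)
include hb

section EscO

variable (hup : ∀ r, ∃ e, ends e = s(u, p r)) {Us : Set V} {l o : V} (hl : l ∉ Us)
  (hext : ∀ r, ∃ e y, ends e = s(p r, y) ∧ y ∉ Us ∧ y ≠ u ∧ ∀ i, y ∉ Ah i)
  (hpout : ∀ i, ∀ y ∈ Ah i, y ≠ o → ∃ e z, ends e = s(y, z) ∧ z ∉ Us ∧ z ≠ h ∧ z ≠ u ∧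
    (∀ r, z ≠ p r) ∧ z ∉ armsAllR U Ah F)
  (hdead : ∀ i, ∃ e y, ends e = s(p (arm i), y) ∧ y ∈ Ah i)
include hup hl hext hpout hdead

/-- **At a non-core slab point that is a `Q`-point the hull of `u` leaves the region**, with the
outside edges required only at the piece vertices other than the mark `o`. -/
theorem MixedBaseR.not_hull_u_subset_of_not_core_o {q : PtR ι ρ ν κ}
    (hq : TSlab q arm ∨ BSlab q arm) (hnc : ¬ Core q arm)
    (hQ : mixedRealR ends u U p Ah F σ q ∈ tgtU ends l h {S : Set V | o ∈ S}) :
    ¬ hull ends (mixedRealR ends u U p Ah F σ q) u ⊆ Us := by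
  intro hsub
  set ζ' := mixedRealR ends u U p Ah F σ q with hζ'
  obtain ⟨hhl, hol, -⟩ := LocRows.mem_tgtU_iff'.1 hQ
  -- the non-uniform arm
  have hne : ∃ r, (q.2.2.1 r ≠ q.2.2.2.1 r) ∨ ∃ i, arm i = r ∧ q.2.1 i ≠ q.2.2.1 r := by
    by_contra hall
    apply hnc
    refine ⟨fun i => ?_, fun r => ?_⟩
    · by_contra hi
      exact hall ⟨arm i, Or.inr ⟨i, rfl, hi⟩⟩
    · by_contra hr
      exact hall ⟨r, Or.inl hr⟩
  obtain ⟨r, hr⟩ := hne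
  obtain ⟨e₁, he₁⟩ := hup r
  have hUP₁ : e₁ ∈ clsUPR ends u p r := he₁
  obtain ⟨e₀, y, he₀, hyU, hyu, hyA⟩ := hext r
  have hX₀ : e₀ ∈ clsExtR ends u p Ah r := ⟨y, he₀, hyu, hyA⟩
  rcases hq with ⟨hs, hT⟩ | ⟨hs, hB⟩
  · -- T-slab: the arm `r` is dropped with blue outside edges or with a red piece
    have huP : q.2.2.1 r = false := by
      cases huP : q.2.2.1 r with
      | false => rfl
      | true =>
        exfalso
        rcases hT r with h' | ⟨ha, he⟩
        · rw [huP] at h'; exact Bool.noConfusion h'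
        · rcases hr with hr | ⟨i, hi, hr⟩
          · rw [huP, he] at hr; exact hr rfl
          · rw [ha i hi, huP] at hr; exact hr rfl
    have hb₁ : blue ζ' e₁ = true := by
      rw [blue_eq_true_iff, hζ', hb.mixedRealR_apply_UP hUP₁, huP, if_neg (by decide),
        hb.u_red e₁ (p r) he₁]
      rfl
    have hpB : p r ∈ cluster ends (blue ζ') u :=
      mem_cluster_of_edge (mem_cluster_self _ _ _) hb₁ he₁
    rcases hr with hr | ⟨i, hi, hr⟩
    · -- the outside edges are blue
      have he : q.2.2.2.1 r = true := by
        cases he : q.2.2.2.1 r with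
        | true => rfl
        | false => rw [huP, he] at hr; exact absurd rfl hr
      have hb₀ : blue ζ' e₀ = true := by
        rw [blue_eq_true_iff, hζ', hb.mixedRealR_apply_Ext hX₀, he, if_pos rfl,
          hb.ext_blue r e₀ y he₀ hyu hyA]
      exact hyU (hsub (Or.inr (mem_cluster_of_edge hpB hb₀ he₀)))
    · -- a red piece: its dead edge is blue; its far end has a blue boundary edge, or is `o`
      have ha : q.2.1 i = true := by
        cases ha : q.2.1 i with
        | true => rfl
        | false => rw [ha, huP] at hr; exact absurd rfl hr
      obtain ⟨e₂, y₂, he₂, hy₂⟩ := hdead i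
      rw [hi] at he₂
      have hA₂ : e₂ ∈ touches ends (Ah i) := MixedBaseR.dead_mem_touches he₂ hy₂
      have hb₂ : blue ζ' e₂ = true := by
        rw [blue_eq_true_iff, hζ', hb.mixedRealR_apply_Ah hA₂, ha, if_pos rfl,
          hb.dead_blue r e₂ y₂ he₂ ⟨i, hy₂⟩]
      have hy₂B : y₂ ∈ cluster ends (blue ζ') u := mem_cluster_of_edge hpB hb₂ he₂
      by_cases hy₂o : y₂ = o
      · -- `o` lies in the red piece: `o ∈ C_R(h)`, so `l ∈ C_R(h)`, against `h ∉ hull(l)`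
        exfalso
        have hoR : o ∈ cluster ends ζ' h := by
          rw [← hy₂o]
          exact cluster_mono (hb.insideConfig_Ah_le ha) h (hb.Ah_conn i y₂ hy₂)
        exact hhl (Or.inl (conn_trans hol (conn_symm hoR)))
      · obtain ⟨e₃, z, he₃, hzU, hzh, hzu, hzp, hzo⟩ := hpout i y₂ hy₂ hy₂o
        have hA₃ : e₃ ∈ touches ends (Ah i) := ⟨y₂, hy₂, z, he₃⟩
        have hb₃ : blue ζ' e₃ = true := by
          rw [blue_eq_true_iff, hζ', hb.mixedRealR_apply_Ah hA₃, ha, if_pos rfl,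
            hb.bdry_blue e₃ y₂ z he₃ (Or.inl (Or.inr (Set.mem_iUnion.2 ⟨i, hy₂⟩))) hzh hzu hzp hzo]
        exact hzU (hsub (Or.inr (mem_cluster_of_edge hy₂B hb₃ he₃)))
  · -- B-slab: the arm `r` is attached red with red outside edges or with a blue piece
    have huP : q.2.2.1 r = true := by
      cases huP : q.2.2.1 r with
      | true => rfl
      | false =>
        exfalso
        rcases hB r with h' | ⟨ha, he⟩
        · rw [huP] at h'; exact Bool.noConfusion h'
        · rcases hr with hr | ⟨i, hi, hr⟩
          · rw [huP, he] at hr; exact hr rfl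
          · rw [ha i hi, huP] at hr; exact hr rfl
    have hr₁ : ζ' e₁ = true := by
      rw [hζ', hb.mixedRealR_apply_UP hUP₁, huP, if_pos rfl, hb.u_red e₁ (p r) he₁]
    have hpR : p r ∈ cluster ends ζ' u :=
      mem_cluster_of_edge (mem_cluster_self _ _ _) hr₁ he₁
    rcases hr with hr | ⟨i, hi, hr⟩
    · have he : q.2.2.2.1 r = false := by
        cases he : q.2.2.2.1 r with
        | false => rfl
        | true => rw [huP, he] at hr; exact absurd rfl hr
      have hr₀ : ζ' e₀ = true := by
        rw [hζ', hb.mixedRealR_apply_Ext hX₀, he, if_neg (by decide),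
          hb.ext_blue r e₀ y he₀ hyu hyA]
        rfl
      exact hyU (hsub (Or.inl (mem_cluster_of_edge hpR hr₀ he₀)))
    · -- a blue piece: its dead edge is red; its far end has a red boundary edge, or is `o`
      have ha : q.2.1 i = false := by
        cases ha : q.2.1 i with
        | false => rfl
        | true => rw [ha, huP] at hr; exact absurd rfl hr
      obtain ⟨e₂, y₂, he₂, hy₂⟩ := hdead i
      rw [hi] at he₂
      have hA₂ : e₂ ∈ touches ends (Ah i) := MixedBaseR.dead_mem_touches he₂ hy₂
      have hr₂ : ζ' e₂ = true := by
        rw [hζ', hb.mixedRealR_apply_Ah hA₂, ha, if_neg (by decide),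
          hb.dead_blue r e₂ y₂ he₂ ⟨i, hy₂⟩]
        rfl
      have hy₂R : y₂ ∈ cluster ends ζ' u := mem_cluster_of_edge hpR hr₂ he₂
      by_cases hy₂o : y₂ = o
      · -- `o ∈ C_R(u)`: then `l ∈ C_R(u) ⊆ hull(u)`, against `l ∉ Us`
        exfalso
        rw [hy₂o] at hy₂R
        exact hl (hsub (Or.inl (conn_trans hy₂R (conn_symm hol))))
      · obtain ⟨e₃, z, he₃, hzU, hzh, hzu, hzp, hzo⟩ := hpout i y₂ hy₂ hy₂o
        have hA₃ : e₃ ∈ touches ends (Ah i) := ⟨y₂, hy₂, z, he₃⟩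
        have hr₃ : ζ' e₃ = true := by
          rw [hζ', hb.mixedRealR_apply_Ah hA₃, ha, if_neg (by decide),
            hb.bdry_blue e₃ y₂ z he₃ (Or.inl (Or.inr (Set.mem_iUnion.2 ⟨i, hy₂⟩))) hzh hzu hzp hzo]
          rfl
        exact hzU (hsub (Or.inl (mem_cluster_of_edge hy₂R hr₃ he₃)))

end EscO

end MixedArms

end Summit.Ventures.PercRepro2
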